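import Summits.FinalStateConjecture.FinalStateConjecture.Theorems.EIHFluxBalanceInertialRecessionStubSlaving3FarFieldPrep

/-!
# Route EIHFluxBalance — `InertialRecession` (E′), line `SketchCleanExcision`, skeleton r13,
# stub `stub_higherOrderSlaving` (EF): jets of a field multiplied by a vanishing linear factor

Helper file for the crux `stmt-FinalStateConjecture-17403`
(`Summit.FinalStateConjecture.FinalStateConjecture.Theses.EIHFluxBalance.InertialRecession`, E′),
registered stub `stub_higherOrderSlaving`.

The comparison fields of the second- and third-order slaving steps are obtained from the frozen
ansatz by adding `(x⁰ − t)ᵏ/k! · W` for a smooth field of bilinear forms `W` (`k = 1, 2, 3`). This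
file computes the `3`-jet at a point `x` with `π(x) = t` of `z ↦ (π z − t) • H z` from the `2`-jet
of `H` (`higherOrder_jets_smul_linear`), and by iteration the jets of `(π z − t)² • H z` and
`(π z − t)³ • H z` (`higherOrder_jets_smul_sq`, `higherOrder_jets_smul_cube`): the only
surviving terms are `π ⊗ π ⊗ 2H(x)`, `sym(π ⊗ π ⊗ 2DH(x))` and `π ⊗ π ⊗ π ⊗ 6H(x)`.

Pure calculus (Leibniz rule); no definitions, no named facts, no `sorry`.
-/

set_option linter.dupNamespace false
set_option maxSynthPendingDepth 3

noncomputable section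

namespace Summit.FinalStateConjecture.FinalStateConjecture.Theorems.SublinearIsFree.Slaving

open scoped Topology ContDiff
open Filter Set Function

section SmulJets

variable {E F : Type*} [NormedAddCommGroup E] [NormedSpace ℝ E] [NormedAddCommGroup F]
  [NormedSpace ℝ F]

/-- The product of a smooth field with the affine scalar `π − t` is smooth. [folklore] -/
theorem higherOrder_contDiffOn_smul_linear (π : E →L[ℝ] ℝ) (t : ℝ) {H : E → F} {U : Set E}
    (hH : ContDiffOn ℝ ∞ H U) : ContDiffOn ℝ ∞ (fun z ↦ (π z - t) • H z) U :=
  (π.contDiff.sub contDiff_const).contDiffOn.smul hH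

/-- **Jets of `(π − t) • H` at a zero of `π − t`.** On an open `U` where `H` is smooth, the field
`L z = (π z − t) • H z` has, at every `z ∈ U`, `DL(z) v = π(v) H(z) + (π z − t) DH(z) v` and
`D²L(z)(v, w) = π(v) DH(z) w + π(w) DH(z) v + (π z − t) D²H(z)(v, w)`; at a point `x ∈ U` with
`π x = t`: `L(x) = 0`, `DL(x) v = π(v) H(x)`, `D²L(x)(v,w) = π(v) DH(x) w + π(w) DH(x) v`,
`D³L(x)(y,v,w) = π(v) D²H(x)(y,w) + π(w) D²H(x)(y,v) + π(y) D²H(x)(v,w)`. [folklore] -/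
theorem higherOrder_jets_smul_linear (π : E →L[ℝ] ℝ) (t : ℝ) {H : E → F} {U : Set E}
    (hU : IsOpen U) (hH : ContDiffOn ℝ ∞ H U) {x : E} (hx : x ∈ U) (hπ : π x = t) :
    (fun z ↦ (π z - t) • H z) x = 0 ∧
    (∀ v, fderiv ℝ (fun z ↦ (π z - t) • H z) x v = π v • H x) ∧
    (∀ v w, fderiv ℝ (fderiv ℝ (fun z ↦ (π z - t) • H z)) x v w =
      π v • fderiv ℝ H x w + π w • fderiv ℝ H x v) ∧
    (∀ y v w, fderiv ℝ (fderiv ℝ (fderiv ℝ (fun z ↦ (π z - t) • H z))) x y v w =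
      π v • fderiv ℝ (fderiv ℝ H) x y w + π w • fderiv ℝ (fderiv ℝ H) x y v +
        π y • fderiv ℝ (fderiv ℝ H) x v w) := by
  set L : E → F := fun z ↦ (π z - t) • H z with hL
  set H₁ := fderiv ℝ H with hH₁
  set H₂ := fderiv ℝ H₁ with hH₂
  set H₃ := fderiv ℝ H₂ with hH₃
  have hH₁c : ContDiffOn ℝ ∞ H₁ U := hH.fderiv_of_isOpen hU (by simp)
  have hH₂c : ContDiffOn ℝ ∞ H₂ U := hH₁c.fderiv_of_isOpen hU (by simp)
  have hdH : ∀ z ∈ U, HasFDerivAt H (H₁ z) z := fun z hz ↦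
    ((hH.differentiableOn (by simp)).differentiableAt (hU.mem_nhds hz)).hasFDerivAt
  have hdH₁ : ∀ z ∈ U, HasFDerivAt H₁ (H₂ z) z := fun z hz ↦
    ((hH₁c.differentiableOn (by simp)).differentiableAt (hU.mem_nhds hz)).hasFDerivAt
  have hdH₂ : ∀ z ∈ U, HasFDerivAt H₂ (H₃ z) z := fun z hz ↦
    ((hH₂c.differentiableOn (by simp)).differentiableAt (hU.mem_nhds hz)).hasFDerivAt
  have hc : ∀ z, HasFDerivAt (fun z ↦ π z - t) π z := fun z ↦ π.hasFDerivAt.sub_const t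
  -- first derivative on `U`
  set L₁ : E → E →L[ℝ] F := fun z ↦ (π z - t) • H₁ z + π.smulRight (H z) with hL₁
  have h1 : ∀ z ∈ U, HasFDerivAt L (L₁ z) z := fun z hz ↦ by
    have h := (hc z).smul (hdH z hz)
    exact h
  have h1eq : ∀ z ∈ U, fderiv ℝ L z = L₁ z := fun z hz ↦ (h1 z hz).fderiv
  -- second derivative on `U`
  set S : F →L[ℝ] (E →L[ℝ] F) := ContinuousLinearMap.smulRightL ℝ E F π with hS
  have hSapp : ∀ (f : F) (w : E), S f w = π w • f := fun f w ↦ by simp [hS]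
  set L₂ : E → E →L[ℝ] E →L[ℝ] F :=
    fun z ↦ ((π z - t) • H₂ z + π.smulRight (H₁ z)) + S.comp (H₁ z) with hL₂
  have h2 : ∀ z ∈ U, HasFDerivAt L₁ (L₂ z) z := fun z hz ↦ by
    have ha : HasFDerivAt (fun z ↦ (π z - t) • H₁ z) ((π z - t) • H₂ z + π.smulRight (H₁ z)) z := by
      have h := (hc z).smul (hdH₁ z hz)
      exact h
    have hb : HasFDerivAt (fun z ↦ π.smulRight (H z)) (S.comp (H₁ z)) z := by
      have h := S.hasFDerivAt.comp z (hdH z hz)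
      have heq : (fun z ↦ π.smulRight (H z)) = S ∘ H := by
        funext z; ext v; simp [hS]
      rw [heq]; exact h
    exact ha.add hb
  have h2eq : ∀ z ∈ U, fderiv ℝ (fderiv ℝ L) z = L₂ z := by
    intro z hz
    have heq : fderiv ℝ L =ᶠ[𝓝 z] L₁ := by
      filter_upwards [hU.mem_nhds hz] with w hw using h1eq w hw
    rw [heq.fderiv_eq, (h2 z hz).fderiv]
  -- third derivative at `x`
  set S₂ : (E →L[ℝ] F) →L[ℝ] (E →L[ℝ] E →L[ℝ] F) :=
    ContinuousLinearMap.smulRightL ℝ E (E →L[ℝ] F) π with hS₂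
  have hS₂app : ∀ (T : E →L[ℝ] F) (v : E), S₂ T v = π v • T := fun T v ↦ by simp [hS₂]
  set Sc : (E →L[ℝ] F) →L[ℝ] (E →L[ℝ] E →L[ℝ] F) :=
    ContinuousLinearMap.compL ℝ E F (E →L[ℝ] F) S with hSc
  have hScapp : ∀ (T : E →L[ℝ] F), Sc T = S.comp T := fun T ↦ rfl
  have h3 : HasFDerivAt L₂ (((π x - t) • H₃ x + π.smulRight (H₂ x)) + S₂.comp (H₂ x) + Sc.comp (H₂ x)) x := by
    have ha : HasFDerivAt (fun z ↦ (π z - t) • H₂ z) ((π x - t) • H₃ x + π.smulRight (H₂ x)) x := by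
      have h := (hc x).smul (hdH₂ x hx)
      exact h
    have hb : HasFDerivAt (fun z ↦ π.smulRight (H₁ z)) (S₂.comp (H₂ x)) x := by
      have h := S₂.hasFDerivAt.comp x (hdH₁ x hx)
      have heq : (fun z ↦ π.smulRight (H₁ z)) = S₂ ∘ H₁ := by
        funext z; ext v w; simp [hS₂]
      rw [heq]; exact h
    have hc' : HasFDerivAt (fun z ↦ S.comp (H₁ z)) (Sc.comp (H₂ x)) x := by
      have h := Sc.hasFDerivAt.comp x (hdH₁ x hx)
      have heq : (fun z ↦ S.comp (H₁ z)) = Sc ∘ H₁ := by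
        funext z; rfl
      rw [heq]; exact h
    exact (ha.add hb).add hc'
  have h3eq : fderiv ℝ (fderiv ℝ (fderiv ℝ L)) x =
      ((π x - t) • H₃ x + π.smulRight (H₂ x)) + S₂.comp (H₂ x) + Sc.comp (H₂ x) := by
    have heq : fderiv ℝ (fderiv ℝ L) =ᶠ[𝓝 x] L₂ := by
      filter_upwards [hU.mem_nhds hx] with w hw using h2eq w hw
    rw [heq.fderiv_eq, h3.fderiv]
  refine ⟨?_, fun v ↦ ?_, fun v w ↦ ?_, fun y v w ↦ ?_⟩
  · show (π x - t) • H x = 0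
    rw [hπ, sub_self, zero_smul]
  · rw [h1eq x hx, hL₁]
    simp [hπ]
  · rw [h2eq x hx, hL₂]
    simp only [_root_.add_apply, ContinuousLinearMap.coe_comp, Function.comp_apply, hSapp,
      _root_.smul_apply, ContinuousLinearMap.smulRight_apply, hπ, sub_self, zero_smul, zero_add]
  · rw [h3eq]
    simp only [_root_.add_apply, ContinuousLinearMap.coe_comp, Function.comp_apply, hScapp, hSapp,
      hS₂app, _root_.smul_apply, ContinuousLinearMap.smulRight_apply, hπ, sub_self, zero_smul,
      zero_add]
    abel

/-- **Jets of `(π − t)² • H` at a zero of `π − t`**: value `0`, first derivative `0`,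
`D²(x)(v,w) = 2 π(v) π(w) H(x)`,
`D³(x)(y,v,w) = 2 (π(v)π(w) DH(x) y + π(y)π(w) DH(x) v + π(y)π(v) DH(x) w)`. [folklore] -/
theorem higherOrder_jets_smul_sq (π : E →L[ℝ] ℝ) (t : ℝ) {H : E → F} {U : Set E}
    (hU : IsOpen U) (hH : ContDiffOn ℝ ∞ H U) {x : E} (hx : x ∈ U) (hπ : π x = t) :
    (fun z ↦ (π z - t) ^ 2 • H z) x = 0 ∧
    fderiv ℝ (fun z ↦ (π z - t) ^ 2 • H z) x = 0 ∧
    (∀ v w, fderiv ℝ (fderiv ℝ (fun z ↦ (π z - t) ^ 2 • H z)) x v w = (2 * (π v * π w)) • H x) ∧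
    (∀ y v w, fderiv ℝ (fderiv ℝ (fderiv ℝ (fun z ↦ (π z - t) ^ 2 • H z))) x y v w =
      (2 * (π v * π w)) • fderiv ℝ H x y + (2 * (π y * π w)) • fderiv ℝ H x v +
        (2 * (π y * π v)) • fderiv ℝ H x w) := by
  -- `(π − t)² H = (π − t) • L` with `L = (π − t) • H`
  set L : E → F := fun z ↦ (π z - t) • H z with hL
  have hLc : ContDiffOn ℝ ∞ L U := higherOrder_contDiffOn_smul_linear π t hH
  have hfun : (fun z ↦ (π z - t) ^ 2 • H z) = fun z ↦ (π z - t) • L z := by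
    funext z; rw [hL, smul_smul, sq]
  obtain ⟨-, hL1, hL2, -⟩ := higherOrder_jets_smul_linear π t hU hH hx hπ
  obtain ⟨hM0, hM1, hM2, hM3⟩ := higherOrder_jets_smul_linear π t hU hLc hx hπ
  have hLx : L x = 0 := by simp [hL, hπ]
  rw [hfun]
  refine ⟨hM0, ?_, fun v w ↦ ?_, fun y v w ↦ ?_⟩
  · ext v
    rw [hM1 v, hLx, smul_zero, _root_.zero_apply]
  · rw [hM2 v w, hL1, hL1, smul_smul, smul_smul, ← add_smul]
    congr 1; ring
  · rw [hM3 y v w, hL2, hL2, hL2]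
    simp only [smul_add, smul_smul]
    have e1 : π y * π v = π v * π y := mul_comm _ _
    have e2 : π y * π w = π w * π y := mul_comm _ _
    have e3 : π v * π w = π w * π v := mul_comm _ _
    rw [two_mul, two_mul, two_mul, add_smul, add_smul, add_smul]
    rw [e3, e2, e1]
    abel

/-- **Jets of `(π − t)³ • H` at a zero of `π − t`**: the `2`-jet vanishes and
`D³(x)(y,v,w) = 6 π(y) π(v) π(w) H(x)`. [folklore] -/
theorem higherOrder_jets_smul_cube (π : E →L[ℝ] ℝ) (t : ℝ) {H : E → F} {U : Set E}
    (hU : IsOpen U) (hH : ContDiffOn ℝ ∞ H U) {x : E} (hx : x ∈ U) (hπ : π x = t) :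
    (fun z ↦ (π z - t) ^ 3 • H z) x = 0 ∧
    fderiv ℝ (fun z ↦ (π z - t) ^ 3 • H z) x = 0 ∧
    fderiv ℝ (fderiv ℝ (fun z ↦ (π z - t) ^ 3 • H z)) x = 0 ∧
    (∀ y v w, fderiv ℝ (fderiv ℝ (fderiv ℝ (fun z ↦ (π z - t) ^ 3 • H z))) x y v w =
      (6 * (π y * π v * π w)) • H x) := by
  set L : E → F := fun z ↦ (π z - t) • H z with hL
  have hLc : ContDiffOn ℝ ∞ L U := higherOrder_contDiffOn_smul_linear π t hH
  set Q : E → F := fun z ↦ (π z - t) • L z with hQ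
  have hQc : ContDiffOn ℝ ∞ Q U := higherOrder_contDiffOn_smul_linear π t hLc
  have hfun : (fun z ↦ (π z - t) ^ 3 • H z) = fun z ↦ (π z - t) • Q z := by
    funext z
    rw [hQ, hL]
    simp only [smul_smul]
    congr 1; ring
  obtain ⟨-, hL1, -, -⟩ := higherOrder_jets_smul_linear π t hU hH hx hπ
  obtain ⟨-, hQ1, hQ2, -⟩ := higherOrder_jets_smul_linear π t hU hLc hx hπ
  obtain ⟨hR0, hR1, hR2, hR3⟩ := higherOrder_jets_smul_linear π t hU hQc hx hπ
  have hLx : L x = 0 := by simp [hL, hπ]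
  have hQx : Q x = 0 := by simp [hQ, hπ]
  have hQ1' : ∀ v, fderiv ℝ Q x v = 0 := fun v ↦ by rw [hQ1 v, hLx, smul_zero]
  have hQ2' : ∀ v w, fderiv ℝ (fderiv ℝ Q) x v w = (2 * (π v * π w)) • H x := fun v w ↦ by
    rw [hQ2 v w, hL1, hL1, smul_smul, smul_smul, ← add_smul]
    congr 1; ring
  rw [hfun]
  refine ⟨hR0, ?_, ?_, fun y v w ↦ ?_⟩
  · ext v
    rw [hR1 v, hQx, smul_zero, _root_.zero_apply]
  · ext v w
    rw [hR2 v w, hQ1', hQ1', smul_zero, smul_zero, add_zero, _root_.zero_apply,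
      _root_.zero_apply]
  · rw [hR3 y v w, hQ2', hQ2', hQ2', smul_smul, smul_smul, smul_smul, ← add_smul, ← add_smul]
    congr 1; ring


/-- **Registered one-line carrier form** (`higherOrder_smulJets_EF`) of `higherOrder_jets_smul_linear`. [folklore] -/
theorem higherOrder_smulJets_EF : ∀ {E F : Type} [NormedAddCommGroup E] [NormedSpace ℝ E] [NormedAddCommGroup F] [NormedSpace ℝ F] (π : E →L[ℝ] ℝ) (t : ℝ) {H : E → F} {U : Set E}, IsOpen U → ContDiffOn ℝ ((⊤ : ℕ∞) : WithTop ℕ∞) H U → ∀ {x : E}, x ∈ U → π x = t → (fun z ↦ (π z - t) • H z) x = 0 ∧ (∀ v, fderiv ℝ (fun z ↦ (π z - t) • H z) x v = π v • H x) ∧ (∀ v w, fderiv ℝ (fderiv ℝ (fun z ↦ (π z - t) • H z)) x v w = π v • fderiv ℝ H x w + π w • fderiv ℝ H x v) ∧ (∀ y v w, fderiv ℝ (fderiv ℝ (fderiv ℝ (fun z ↦ (π z - t) • H z))) x y v w = π v • fderiv ℝ (fderiv ℝ H) x y w + π w • fderiv ℝ (fderiv ℝ H) x y v + π y • fderiv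 ℝ (fderiv ℝ H) x v w) :=
  fun π t _ _ hU hH _ hx hπ ↦ higherOrder_jets_smul_linear π t hU hH hx hπ

end SmulJets

end Summit.FinalStateConjecture.FinalStateConjecture.Theorems.SublinearIsFree.Slaving

end
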